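import Literature.NumberTheory.Automorphic.ReciprocityGLnExistenceProofs
import Literature.NumberTheory.Automorphic.BaseChangeArchimedeanRankOne
import Literature.NumberTheory.Automorphic.GLnCentralCharacter
import Literature.NumberTheory.GaloisRepresentations.WeilLAdicCharacterProofs
import HarnessLib

/-!
# Harris–Lan–Taylor–Thorne, Thm. A (existence): the case `n = 1` ("well known"), proved, and
# Thm. A from its automorphic leaves without the rank-one hypothesis

Topic `Literature/NumberTheory/Automorphic`; theorems only (no definition, no named fact, no
instance).  Companion of `ReciprocityGLnExistenceProofs`, whose theorem
`HarrisLanTaylorThorne2016.theoremA_existence_of_leaves` reduces the named fact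
`HarrisLanTaylorThorne2016.theoremA_existence` (`ReciprocityGLnProofs`; Harris–Lan–Taylor–Thorne,
Res. Math. Sci. 3:37 (2016), Thm. A, p. 3 = Cor. 7.14, p. 232) to three automorphic leaves and to
**its own case `n = 1`** (hypothesis `h₁` there) — "We may suppose that `n > 1`, as in the case
`n = 1` the result is well known" (proof of Thm. 7.13, p. 232).  The case `n = 1` is Weil's theorem
on the `ℓ`-adic characters of algebraic Hecke characters (A. Weil, 1956), proved in the tree as
`HeckeCharacter.IsAlgebraic.exists_lAdic` (`GaloisRepresentations/WeilLAdicCharacterProofs`); what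
was missing is the passage from a regular algebraic cuspidal automorphic representation `π` of
`GL₁(𝔸_K)` in the Borel–Jacquet datum model (`CuspidalAutomorphicRepData 1 K hcpt`) to an
*algebraic* Hecke character with the same unramified local data.  This file supplies it and
removes `h₁`:

* `AutomorphicRepData.isUnramifiedAt_heckeCharacter_glOne` — **the Hecke character `χ_π` of `π`
  (`AutomorphicRepData.exists_heckeCharacter_glOne`) is unramified wherever `π` is**: a
  `K(𝔫)`-fixed form `φ ∈ W ∖ W'` with `v ∤ 𝔫` is fixed by the scalars `u ∈ 𝒪_vˣ ⊆ K(𝔫)`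
  (`scalar_localUnits_mem_of_isMaximalAt`, `isMaximalAt_principalCongruenceLevel`), on which `χ_π`
  therefore takes the value `1` (Tate 1950, §2.3; Borel–Jacquet 1979, 4.6).
* `AutomorphicRepData.exists_hasInfinityType_heckeCharacter_glOne`,
  `…isAlgebraic_heckeCharacter_glOne_of_isCAlgebraic` — **the Hecke character of a `C`-algebraic
  automorphic representation of `GL₁(𝔸_K)` is algebraic (Weil's type `A₀`)**: if `π` has a
  `C`-algebraic infinity type `T` (for `n = 1`: integer exponents `T(σ) = {(k_σ, ·)}`), then near `1`
  on the infinite ideles `χ_π(x) = ∏_{w real} ι_w(x_w)^{k_{σ_w}} ∏_{w complex} ι_w(x_w)^{k_{σ_w}}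
  \overline{ι_w(x_w)}^{k_{σ̄_w}}`, i.e. `χ_π` has infinity type `(p, q) = (-k_σ, -k_{σ̄})`
  (`HeckeCharacter.HasInfinityType`).  Proof: `𝔤𝔩₁(K_∞)` acts on the line `W / W'` through a real
  linear form `d` with `χ_π(det exp Y) = e^{d(Y)}` (`AutomorphicRepsGLOneHeckeCharacter`); the
  Harish-Chandra parameter clauses give `d(1_w) = k_{σ_w}` at a real place and
  `d(a_w) = a k_{σ_w} + ā k_{σ̄_w}` at a complex place (`archParameter_clauses_glOne`, `HCEmb.sum_proj`,
  `proj_smul`); a totally positive infinite idele `x` is `det exp Y` for `Y = log x` coordinatewise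
  (`extensionEmbedding_det_ofInfinite_expGL`), and `e^{k log z} = z^k`.  (Clozel 1990, §1 and §3.3 for
  `n = 1`: algebraic automorphic representations of `GL(1)` are the Hecke characters of type `A₀`;
  Weil 1956, §1.)
* `HarrisLanTaylorThorne2016.theoremA_existence_rank_one` — **Thm. A (existence) for `n = 1`**,
  proved: for `π` cuspidal regular algebraic on `GL₁(𝔸_K)` (any number field `K`), `ℓ`, `ι`, Weil's
  `ℓ`-adic character `r` of `χ_π` is semisimple (rank one) and HLTT-compatible with `π`
  (`IsCompatible`): at a place `v ∤ ℓ` where `π` has Satake parameter `α`, `α = {χ_π(ϖ_v)}`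
  (`exists_eq_singleton_of_hasSatakeParamAt_glOne`), `χ_π` is unramified, and `r` is unramified with
  `char(Frob_v) = X - ι⁻¹(χ_π(ϖ_v))⁻¹ = arithFrobPolyOfSatake ι q_v 1 α`.
* `HarrisLanTaylorThorne2016.theoremA_existence_of_leaves'` — `theoremA_existence` (all `n`) from
  the three automorphic leaves of `theoremA_existence_of_baseChange` alone: HLTT Cor. 6.27
  (`corollary627_splitOrUnramified`, named fact), the archimedean clause of Arthur–Clozel's strong
  lifting (`ArthurClozel1989_strongLifting_archimedean`, named fact) and Arthur–Clozel's strong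
  cuspidal base change in prime degree (Ch. 3, Thm. 4.2 (a) with Thm. 5.1; hypothesis `hBC`, for
  which the tree has no named fact).  This is the exact residue of a discharge
  `theoremA_existence_holds` after this file.

## References

* M. Harris, K.-W. Lan, R. Taylor, J. Thorne, *On the rigid cohomology of certain Shimura
  varieties*, Res. Math. Sci. 3:37 (2016), Thm. A (p. 3), Thm. 7.13 and Cor. 7.14 (p. 232).
  [HarrisLanTaylorThorneRMS2016]
* A. Weil, *On a certain type of characters of the idèle-class group of an algebraic
  number-field*, Proc. Int. Symp. Tokyo–Nikko 1955 (1956), 1–7, §1. [Weil1956]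
* L. Clozel, *Motifs et formes automorphes* (1990), §1.1, Déf. 1.8, §3.3. [Clozel1990]
* A. Borel, H. Jacquet, Corvallis (1979), Part 1, §4.6. [BorelJacquet1979]
* J. Tate, *Fourier analysis in number fields and Hecke's zeta-functions* (1950/1967), §2.3.
  [TateThesis1967]
-/

noncomputable section

open scoped MatrixGroups Matrix Classical Polynomial NumberField ComplexConjugate
open NumberField NumberField.InfinitePlace NumberField.mixedEmbedding IsDedekindDomain Filter
  Polynomial
open _root_.Topology

namespace Literature.NumberTheory.Automorphic

open Literature.NumberTheory.GaloisRepresentations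

/-! ### §1. The Hecke character of a `GL₁` datum: ramification and infinity type -/

section GLOne

variable {K : Type} [Field K] [NumberField K] {hcpt : isCompact_glFiniteIntegralLevel 1 K}

/-- **`χ_π` is unramified wherever `π` is.**  Let `π = W / W'` be an automorphic representation of
`GL₁(𝔸_K)` with Hecke character `χ` (`r(g) φ - χ(det g) φ ∈ W'`).  If `π` has a Satake parameter at
`v` — so that some `φ ∈ W ∖ W'` is fixed by a principal congruence subgroup `K(𝔫)` with `v ∤ 𝔫` —
then `χ` is trivial on `𝒪_vˣ`: the scalar idele `u ∈ 𝒪_vˣ` lies in `K(𝔫)`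
(`scalar_localUnits_mem_of_isMaximalAt`), fixes `φ`, and acts by `χ(u)`.
Tate (1950), §2.3; Borel–Jacquet 1979, 4.6. [cite: BorelJacquet1979, 4.6] -/
theorem AutomorphicRepData.isUnramifiedAt_heckeCharacter_glOne
    (π : AutomorphicRepData (AutomorphyDatum.gl 1 K hcpt)) {χ : HeckeCharacter K}
    (hχ : ∀ (g : (AdelicGroupData.gl 1 K).Adelic), ∀ φ ∈ π.W,
      rightTranslation (AdelicGroupData.gl 1 K) g φ -
        ((χ (Matrix.GeneralLinearGroup.det g) : ℂˣ) : ℂ) • φ ∈ π.W')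
    {v : HeightOneSpectrum (𝓞 K)} {α : Multiset ℂ} (hα : π.HasSatakeParamAt v α) :
    χ.IsUnramifiedAt v := by
  obtain ⟨𝔫, ϖ, h𝔫, hv, -, -, φ, hφW, hφW', hfix, -⟩ := hα
  intro u
  set g : (AdelicGroupData.gl 1 K).Adelic := Matrix.GeneralLinearGroup.scalar (Fin 1)
    (localUnits v (Units.map ((v.adicCompletionIntegers K).subtype : _ →* _) u)) with hg
  have hgmem : g ∈ principalCongruenceLevel 1 K 𝔫 :=
    scalar_localUnits_mem_of_isMaximalAt (isMaximalAt_principalCongruenceLevel 1 K v h𝔫 hv) u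
  have h1 := hχ g φ hφW
  rw [hfix g hgmem, hg, det_generalLinearGroup_scalar_fin_one] at h1
  have h2 : φ - (1 : ℂ) • φ ∈ π.W' := by
    rw [one_smul, sub_self]
    exact π.W'.zero_mem
  have key := eq_of_sub_smul_mem_of_not_mem h2 h1 hφW'
  refine Units.ext ?_
  rw [HeckeCharacter.localComponent_apply, Units.val_one]
  exact key.symm

/-- **The Hecke character of a `C`-algebraic automorphic representation of `GL₁(𝔸_K)` has an
infinity type.**  Let `π = W / W'` be an automorphic representation of `GL₁(𝔸_K)` with Hecke
character `χ` and with a `C`-algebraic infinity type `T` (`n = 1`: `T(σ) = {(k_σ, ·)}` with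
`k_σ ∈ ℤ`).  Then there are `p, q : (places at ∞) → ℤ` with
`χ((x, 1)) = ∏_w ι_w(x_w)^{-p_w} \overline{ι_w(x_w)}^{-q_w}` for all `x` in a neighbourhood of `1`
in `(K ⊗ ℝ)ˣ` (`HeckeCharacter.HasInfinityType`; in fact `p_w = -k_{σ_w}`, and `q_w = -k_{σ̄_w}` at a
complex `w`, `q_w = 0` at a real `w`, the neighbourhood being the totally positive ideles).
The Lie algebra `𝔤𝔩₁(K_∞)` acts on the line `W / W'` through a real linear form `d` with
`χ(det exp Y) = e^{d(Y)}` (`heckeCharacter_glOne_det_ofArch_expMem`); the clauses of the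
Harish-Chandra parameter (`archParameter_clauses_glOne`) read `d(1_w) = k_{σ_w}` at a real place and,
with `HCEmb.sum_proj` / `proj_smul`, `d(a_w) = a k_{σ_w} + ā k_{σ̄_w}` at a complex place; a
totally positive `x` is `det exp Y` for the coordinatewise logarithm `Y` of `x`
(`extensionEmbedding_det_ofInfinite_expGL`).  Clozel 1990, §1.1 and §3.3 (`n = 1`); Weil 1956, §1
(type `A₀`). [cite: Clozel1990, §3.3] [cite: Weil1956, §1] -/
theorem AutomorphicRepData.exists_hasInfinityType_heckeCharacter_glOne
    (π : AutomorphicRepData (AutomorphyDatum.gl 1 K hcpt)) {χ : HeckeCharacter K}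
    (hχ : ∀ (g : (AdelicGroupData.gl 1 K).Adelic), ∀ φ ∈ π.W,
      rightTranslation (AdelicGroupData.gl 1 K) g φ -
        ((χ (Matrix.GeneralLinearGroup.det g) : ℂˣ) : ℂ) • φ ∈ π.W')
    {T : InfinityType K 1} (hT : π.HasInfinityType T) (hTC : T.IsCAlgebraic) :
    ∃ p q : InfinitePlace K → ℤ, χ.HasInfinityType p q := by
  classical
  obtain ⟨hTwf, hTarch⟩ := hT
  -- the integer exponents `k σ`: `(T σ).map a = {k σ}`
  have hk : ∀ σ : K →+* ℂ, ∃ k : ℤ, (T σ).map ArchWeight.a = {(k : ℂ)} := by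
    intro σ
    obtain ⟨w₀, hw₀⟩ := Multiset.card_eq_one.1 (hTwf.1 σ)
    obtain ⟨k, l, hka, -⟩ := hTC σ w₀ (by rw [hw₀]; exact Multiset.mem_singleton_self w₀)
    refine ⟨k, ?_⟩
    rw [hw₀, Multiset.map_singleton, hka]
    simp
  choose k hk using hk
  -- the Lie algebra acts on the line `W / W'` through the real linear form `d`
  obtain ⟨ρ, hρ⟩ := π.exists_hasLieAction_gl
  obtain ⟨d', hd'⟩ := π.exists_linearMap_lieAction_eq_smul_one_glOne ρ
  obtain ⟨d, hd⟩ : ∃ d : Matrix (Fin 1) (Fin 1) (mixedSpace K) →ₗ[ℝ] ℂ,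
      ∀ Y, d Y = d' ⟨Y, trivial⟩ :=
    ⟨{ toFun := fun Y => d' ⟨Y, trivial⟩
       map_add' := fun Y Z => map_add d' ⟨Y, trivial⟩ ⟨Z, trivial⟩
       map_smul' := fun c Y => map_smul d' c ⟨Y, trivial⟩ }, fun _ => rfl⟩
  -- the link `χ(det (exp Y, 1)) = e^{d(Y)}`
  have hlink : ∀ Y : Matrix (Fin 1) (Fin 1) (mixedSpace K),
      ((χ (Matrix.GeneralLinearGroup.det (GLn.ofInfinite 1 K (expGL Y))) : ℂˣ) : ℂ) =
        Complex.exp (d Y) := by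
    intro Y
    have h := π.heckeCharacter_glOne_det_ofArch_expMem hχ ⟨Y, trivial⟩
      (fun φ hφ => π.lieDeriv_sub_smul_mem_of_hasLieAction_glOne hρ hd' ⟨Y, trivial⟩ hφ) 1
    rw [one_smul, Complex.ofReal_one, one_mul, ← hd] at h
    exact h
  -- the clauses of the archimedean parameter `σ ↦ (T σ).map a`
  obtain ⟨hre, hco⟩ := π.archParameter_clauses_glOne hρ d' hd' hTarch
  have hreal : ∀ w : {w : InfinitePlace K // w.IsReal},
      d (realPlaceLie 1 w (1 : Matrix (Fin 1) (Fin 1) ℝ)) = (k w.1.embedding : ℂ) := by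
    intro w
    rw [hd]
    exact Multiset.singleton_inj.1 ((hre w).symm.trans (hk _))
  have hcomplex : ∀ (w : {w : InfinitePlace K // w.IsComplex}) (τ : ℂ →ₐ[ℝ] ℂ),
      HCEmb.proj (fun a : ℂ =>
          d' ⟨complexPlaceLie 1 w (a • (1 : Matrix (Fin 1) (Fin 1) ℂ)), trivial⟩) τ 1 =
        (k (τ.toRingHom.comp w.1.embedding) : ℂ) := by
    intro w τ
    exact Multiset.singleton_inj.1 ((hco w τ).symm.trans (hk _))
  -- at a real place: `e^{d(r · 1_w)} = (e^r)^{k σ_w}`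
  have hexpR : ∀ (w : {w : InfinitePlace K // w.IsReal}) (r : ℝ),
      Complex.exp (d (realPlaceLie 1 w (r • (1 : Matrix (Fin 1) (Fin 1) ℝ)))) =
        Complex.exp r ^ k w.1.embedding := by
    intro w r
    rw [map_smul, map_smul, hreal w, Complex.real_smul, mul_comm, Complex.exp_int_mul]
  -- at a complex place: `e^{d(a_w)} = (e^a)^{k σ_w} (e^{ā})^{k σ̄_w}`
  have hexpC : ∀ (w : {w : InfinitePlace K // w.IsComplex}) (a : ℂ),
      Complex.exp (d (complexPlaceLie 1 w (a • (1 : Matrix (Fin 1) (Fin 1) ℂ)))) =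
        Complex.exp a ^ k w.1.embedding *
          Complex.exp (conj a) ^ k (ComplexEmbedding.conjugate w.1.embedding) := by
    intro w a
    -- the real linear form `L(b) = d(b_w)` and its decomposition along `τ ∈ {id, conj}`
    let L : ℂ →ₗ[ℝ] ℂ :=
      { toFun := fun b => d (complexPlaceLie 1 w (b • (1 : Matrix (Fin 1) (Fin 1) ℂ)))
        map_add' := fun b c => by
          show d (complexPlaceLie 1 w ((b + c) • (1 : Matrix (Fin 1) (Fin 1) ℂ))) =
            d (complexPlaceLie 1 w (b • (1 : Matrix (Fin 1) (Fin 1) ℂ))) +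
              d (complexPlaceLie 1 w (c • (1 : Matrix (Fin 1) (Fin 1) ℂ)))
          rw [add_smul, map_add, map_add]
        map_smul' := fun r b => by
          show d (complexPlaceLie 1 w ((r • b) • (1 : Matrix (Fin 1) (Fin 1) ℂ))) =
            r • d (complexPlaceLie 1 w (b • (1 : Matrix (Fin 1) (Fin 1) ℂ)))
          rw [smul_assoc, map_smul, map_smul] }
    have hL : ∀ b : ℂ, L b = d (complexPlaceLie 1 w (b • (1 : Matrix (Fin 1) (Fin 1) ℂ))) :=
      fun b => rfl
    have hLf : (L : ℂ → ℂ) =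
        fun b : ℂ => d' ⟨complexPlaceLie 1 w (b • (1 : Matrix (Fin 1) (Fin 1) ℂ)), trivial⟩ :=
      funext fun b => (hL b).trans (hd _)
    have hsum : L a = ∑ τ : ℂ →ₐ[ℝ] ℂ, τ a * HCEmb.proj (L : ℂ → ℂ) τ 1 := by
      have h := HCEmb.sum_proj (𝕜 := ℂ) L.toAddMonoidHom a
      rw [LinearMap.toAddMonoidHom_coe] at h
      rw [← h]
      refine Finset.sum_congr rfl fun τ _ => ?_
      have h2 := HCEmb.proj_smul L τ a (1 : ℂ)
      rw [smul_eq_mul, mul_one, smul_eq_mul] at h2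
      exact h2
    have huniv : (Finset.univ : Finset (ℂ →ₐ[ℝ] ℂ)) =
        {AlgHom.id ℝ ℂ, (Complex.conjAe : ℂ →ₐ[ℝ] ℂ)} := by
      ext τ
      simp only [Finset.mem_univ, Finset.mem_insert, Finset.mem_singleton, true_iff]
      exact Complex.real_algHom_eq_id_or_conj τ
    have hne : AlgHom.id ℝ ℂ ≠ (Complex.conjAe : ℂ →ₐ[ℝ] ℂ) := fun h => by
      have h1 : (Complex.I : ℂ) = conj Complex.I :=
        congrArg (fun f : ℂ →ₐ[ℝ] ℂ => f Complex.I) h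
      rw [Complex.conj_I] at h1
      exact Complex.I_ne_zero (by linear_combination h1 / 2)
    have hid : (AlgHom.id ℝ ℂ) a = a := rfl
    have hca : (Complex.conjAe : ℂ →ₐ[ℝ] ℂ) a = conj a := rfl
    rw [← hL a, hsum, huniv, Finset.sum_pair hne, hLf, hcomplex w, hcomplex w,
      algHomId_toRingHom_comp, conjAe_toRingHom_comp, hid, hca, Complex.exp_add, mul_comm a,
      mul_comm (conj a), Complex.exp_int_mul, Complex.exp_int_mul]
  -- the infinity type `(p, q) = (-k σ_w, -k σ̄_w)` on the totally positive infinite ideles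
  refine ⟨fun w => -k w.embedding,
    fun w => if w.IsReal then 0 else -k (ComplexEmbedding.conjugate w.embedding),
    {x | InfiniteIdele.IsTotallyPositive x}, ?_, fun x hx => ?_⟩
  · -- the totally positive infinite ideles form a neighbourhood of `1`
    have hpos : ∀ w : {w : InfinitePlace K // w.IsReal}, ∀ᶠ x : (InfiniteAdeleRing K)ˣ in 𝓝 1,
        0 < Completion.extensionEmbeddingOfIsReal w.2 ((x : InfiniteAdeleRing K) w.1) := by
      intro w
      have hc : Continuous fun x : (InfiniteAdeleRing K)ˣ =>
          Completion.extensionEmbeddingOfIsReal w.2 ((x : InfiniteAdeleRing K) w.1) :=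
        (Completion.isometry_extensionEmbeddingOfIsReal w.2).continuous.comp
          ((continuous_apply w.1).comp Units.continuous_val)
      refine (isOpen_lt continuous_const hc).mem_nhds ?_
      show (0 : ℝ) < Completion.extensionEmbeddingOfIsReal w.2 1
      rw [map_one]
      exact one_pos
    filter_upwards [eventually_all.2 hpos] with x hx
    exact fun w hw => hx ⟨w, hw⟩
  · -- the identity `χ((x, 1)) = ∏_w ι_w(x_w)^{k σ_w} conj(ι_w(x_w))^{k σ̄_w}` at such an `x`
    -- the coordinatewise logarithm `y` of `x` and `Y = y · 1 ∈ 𝔤𝔩₁(K_∞)`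
    obtain ⟨y, hy1, hy2⟩ : ∃ y : mixedSpace K,
        (∀ w : {w : InfinitePlace K // w.IsReal},
          y.1 w = Real.log (Completion.extensionEmbeddingOfIsReal w.2 ((x : InfiniteAdeleRing K) w.1))) ∧
        ∀ w : {w : InfinitePlace K // w.IsComplex},
          y.2 w = Complex.log (Completion.extensionEmbedding w.1 ((x : InfiniteAdeleRing K) w.1)) :=
      ⟨(fun w => Real.log (Completion.extensionEmbeddingOfIsReal w.2 ((x : InfiniteAdeleRing K) w.1)),
        fun w => Complex.log (Completion.extensionEmbedding w.1 ((x : InfiniteAdeleRing K) w.1))),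
        fun _ => rfl, fun _ => rfl⟩
    have hY00 : (y • (1 : Matrix (Fin 1) (Fin 1) (mixedSpace K))) 0 0 = y := by
      rw [Matrix.smul_apply, Matrix.one_apply_eq, smul_eq_mul, mul_one]
    -- `(x, 1) = det (exp Y, 1)` as ideles
    have hxY : infiniteIdeles K x = Matrix.GeneralLinearGroup.det
        (GLn.ofInfinite 1 K (expGL (y • (1 : Matrix (Fin 1) (Fin 1) (mixedSpace K))))) := by
      refine idele_eq_of_snd_eq_of_extensionEmbedding_eq K ?_ fun w => ?_
      · rw [det_ofInfinite_snd]
        rfl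
      · rw [extensionEmbedding_det_ofInfinite_expGL, hY00, infiniteIdeles_fst]
        by_cases hw : w.IsReal
        · rw [dif_pos hw, hy1 ⟨w, hw⟩, Real.exp_log (hx w hw),
            Completion.extensionEmbeddingOfIsReal_apply]
        · rw [dif_neg hw, hy2 ⟨w, not_isReal_iff_isComplex.1 hw⟩,
            Complex.exp_log (InfiniteIdele.extensionEmbedding_apply_ne_zero x w)]
    rw [hxY, hlink, linearMap_smul_one_eq_sum d y, Complex.exp_add, Complex.exp_sum,
      Complex.exp_sum, HeckeCharacter.archFactor_apply, prod_eq_prod_mul_prod]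
    congr 1
    · -- real places
      refine Finset.prod_congr rfl fun w _ => ?_
      rw [hexpR, if_pos w.2, neg_zero, zpow_zero, mul_one, neg_neg, hy1 w, ← Complex.ofReal_exp,
        Real.exp_log (hx w.1 w.2), Completion.extensionEmbeddingOfIsReal_apply]
    · -- complex places
      refine Finset.prod_congr rfl fun w _ => ?_
      have hw : ¬ w.1.IsReal := not_isReal_iff_isComplex.2 w.2
      rw [hexpC, if_neg hw, neg_neg, neg_neg, hy2 w, Complex.exp_conj,
        Complex.exp_log (InfiniteIdele.extensionEmbedding_apply_ne_zero x w.1)]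

/-- **The Hecke character of a `C`-algebraic automorphic representation of `GL₁(𝔸_K)` is algebraic**
(of type `A₀`, `HeckeCharacter.IsAlgebraic`): Clozel's dictionary for `n = 1` — the algebraic
automorphic representations of `GL(1)` are the Hecke characters of type `A₀`
(`exists_hasInfinityType_heckeCharacter_glOne`, `HeckeCharacter.isAlgebraic_iff_exists_hasInfinityType`).
Clozel 1990, §1.1 and Déf. 1.8 (`n = 1`); Weil 1956, §1. [cite: Clozel1990, Déf. 1.8] [cite: Weil1956, §1] -/
theorem AutomorphicRepData.isAlgebraic_heckeCharacter_glOne_of_isCAlgebraic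
    (π : AutomorphicRepData (AutomorphyDatum.gl 1 K hcpt)) {χ : HeckeCharacter K}
    (hχ : ∀ (g : (AdelicGroupData.gl 1 K).Adelic), ∀ φ ∈ π.W,
      rightTranslation (AdelicGroupData.gl 1 K) g φ -
        ((χ (Matrix.GeneralLinearGroup.det g) : ℂˣ) : ℂ) • φ ∈ π.W')
    (hπ : π.IsCAlgebraic) : χ.IsAlgebraic := by
  obtain ⟨T, hT, hTC⟩ := hπ
  obtain ⟨p, q, h⟩ := π.exists_hasInfinityType_heckeCharacter_glOne hχ hT hTC
  exact (χ.isAlgebraic_iff_exists_hasInfinityType).2 ⟨p, q, h⟩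

end GLOne

/-! ### §2. Thm. A (existence) in rank one, and Thm. A from its automorphic leaves -/

namespace HarrisLanTaylorThorne2016

variable {K : Type} [Field K] [NumberField K] {ℓ : ℕ} [Fact ℓ.Prime]

/-- **Harris–Lan–Taylor–Thorne 2016, Theorem A — existence, case `n = 1`** ("in the case `n = 1`
the result is well known", proof of Thm. 7.13, p. 232), proved for every number field `K`: for a
cuspidal regular algebraic automorphic representation `π` of `GL₁(𝔸_K)` (Borel–Jacquet datum), a
prime `ℓ` and `ι : ℚ̄_ℓ ≃+* ℂ`, there is a continuous semisimple `r : Γ_K → GL₁(ℚ̄_ℓ)` with HLTT's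
property (`IsCompatible`): at every place `v` over a rational prime `q ≠ ℓ` above which `π` is
unramified, and for every Satake parameter `α` of `π` at `v`, `r` is unramified at `v` with
arithmetic-Frobenius characteristic polynomial `arithFrobPolyOfSatake ι q_v 1 α`.  Proof: `π` has
an algebraic Hecke character `χ_π` (`exists_heckeCharacter_glOne`,
`isAlgebraic_heckeCharacter_glOne_of_isCAlgebraic`), whose `ℓ`-adic character `r` (Weil 1956,
`HeckeCharacter.IsAlgebraic.exists_lAdic`; semisimple, being of rank one:
`FramedRep.isSemisimple_of_rank_one`) is unramified at the places `v ∤ ℓ` where `χ_π` is, with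
`char(Frob_v) = X - ι⁻¹(χ_π(ϖ_v))⁻¹`; and where `π` is unramified so is `χ_π`
(`isUnramifiedAt_heckeCharacter_glOne`), with `α = {χ_π(ϖ_v)}`
(`exists_eq_singleton_of_hasSatakeParamAt_glOne`, `arithFrobPolyOfSatake_one`).  The hypothesis
"`K` totally real or CM" of Thm. A is not needed in rank one.
[cite: HarrisLanTaylorThorneRMS2016, Thm. A (p. 3), proof of Thm. 7.13 (p. 232, case n = 1)]
[cite: Weil1956, §1–§2] -/
theorem theoremA_existence_rank_one (hcpt : isCompact_glFiniteIntegralLevel 1 K)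
    (π : CuspidalAutomorphicRepData 1 K hcpt) (hπ : π.1.IsRegularAlgebraic)
    (ι : PadicAlgCl ℓ ≃+* ℂ) :
    ∃ r : FramedGaloisRep K (PadicAlgCl ℓ) 1, r.toGaloisRep.IsSemisimple ∧ IsCompatible π.1 ι r := by
  classical
  obtain ⟨χ, hχ⟩ := π.1.exists_heckeCharacter_glOne
  have halg : χ.IsAlgebraic :=
    π.1.isAlgebraic_heckeCharacter_glOne_of_isCAlgebraic hχ hπ.isCAlgebraic
  obtain ⟨r, hr⟩ := halg.exists_lAdic ι
  refine ⟨r, FramedRep.isSemisimple_of_rank_one r, fun q hq hqℓ _ v hqv α hα => ?_⟩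
  have hvℓ : ((ℓ : ℕ) : 𝓞 K) ∉ v.asIdeal := natCast_not_mem_of_natCast_mem hq Fact.out hqℓ hqv
  have hur : χ.IsUnramifiedAt v := π.1.isUnramifiedAt_heckeCharacter_glOne hχ hα
  obtain ⟨hunr, hfrob⟩ := hr v hvℓ hur
  refine ⟨hunr, ?_⟩
  obtain ⟨ϖ, hϖ, rfl⟩ := π.1.exists_eq_singleton_of_hasSatakeParamAt_glOne hχ hα
  have hc : ((χ (localUnits v ϖ) : ℂˣ) : ℂ) = χ.valueAtUniformizer v := by
    rw [← HeckeCharacter.localComponent_eq_valueAtUniformizer hur hϖ,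
      HeckeCharacter.localComponent_apply]
  rw [arithFrobPolyOfSatake_one, Multiset.map_singleton, Multiset.prod_singleton, hc]
  exact hfrob

/-- **Thm. A (existence), all `n`, from its three automorphic leaves** — `theoremA_existence_of_leaves`
with its rank-one hypothesis `h₁` discharged by `theoremA_existence_rank_one`: granted HLTT
Cor. 6.27 (`corollary627_splitOrUnramified`), the archimedean clause of Arthur–Clozel's strong lifting
(`ArthurClozel1989_strongLifting_archimedean`) and Arthur–Clozel's strong cuspidal base change in
prime degree for extensions ramified at a place where `π` is unramified (Ch. 3, Thm. 4.2 (a) with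
Thm. 5.1 and (1.1); hypothesis `hBC`), `theoremA_existence` holds.  This is exactly what a discharge
`theoremA_existence_holds` still requires.
[cite: HarrisLanTaylorThorneRMS2016, Thm. A (p. 3), Cor. 7.14 and proof of Thm. 7.13 (p. 232)] -/
theorem theoremA_existence_of_leaves' (h627 : corollary627_splitOrUnramified)
    (harch : ArthurClozel1989_strongLifting_archimedean)
    (hBC : ∀ (n : ℕ) (F E : Type) [Field F] [NumberField F] [Field E] [NumberField E] [Algebra F E]
      [IsGalois F E], (Module.finrank F E).Prime →
      ∀ (hF : isCompact_glFiniteIntegralLevel n F) (π : CuspidalAutomorphicRepData n F hF),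
        (∃ v : HeightOneSpectrum (𝓞 F),
            ¬ Algebra.IsUnramifiedIn (𝓞 E) v.asIdeal ∧ π.1.IsUnramifiedAt v) →
        ∀ (hE : isCompact_glFiniteIntegralLevel n E),
          ∃ P : CuspidalAutomorphicRepData n E hE,
            ∀ (w : HeightOneSpectrum (𝓞 E)) (v : HeightOneSpectrum (𝓞 F)) (α : Multiset ℂ),
              w.asIdeal.under (𝓞 F) = v.asIdeal → Algebra.IsUnramifiedIn (𝓞 E) v.asIdeal →
                π.1.HasSatakeParamAt v α →
                  P.1.HasSatakeParamAt w (α.map (· ^ w.asIdeal.inertiaDeg (𝓞 F)))) :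
    theoremA_existence := by
  refine theoremA_existence_of_leaves h627 harch hBC ?_
  intro K _ _ hcpt _ π hπ ℓ _ ι
  exact theoremA_existence_rank_one hcpt π hπ ι

end HarrisLanTaylorThorne2016

end Literature.NumberTheory.Automorphic

end
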